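import Summits.Ventures.PercRepro.Night2FatDDStruct
import Summits.Ventures.PercRepro.Night2FatDegFree
import Summits.Ventures.PercRepro.Night2FatZThreeB

/-!
# night-2: the doubly degenerate regime — the cell quantities of a basis pair

With `V = (G ∖ K) ∖ {w₀, x} = P₀ ⊔ W` (`P₀` the four basis points, `W = (G ∖ Q) ∖ {x}`) and the three cells — the
spine `clF R₁`, `A = π₂ ∖ clF R₁`, `M = π₃ ∖ clF R₁` — let `n_L, n_A, n_M` count the basis points and `t_L, t_A, t_M`
the points of `W` in the cells.  **`dd_cell_facts`**: `n_L + n_A + n_M = 4`, `t_L + t_A + t_M = |W|`,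
`n_L + n_A ≤ 3`, `n_L + n_M ≤ 3` (independent points of a rank-3 plane), `3 ≤ t_L + n_L` (`R₁`), `3 ≤ n_A + t_A`,
`3 ≤ n_M + t_M` (`three_le_card_side_of_fat`), and the line of `A` carries `n₂ ∈ {n_A, n_A + 1}` basis points and
`s₂ ∈ {t_A, t_A + 1}` points of `W` with at most one excess (the spine meets `clF A` in at most one point);
likewise the line of `M`.  Paper `proofs/NIGHT-2-g35.md` §7.
-/

namespace PercRepro.Shadow

open PercRepro.ThmH PercRepro.PerFlat

variable {α : Type*} [DecidableEq α] {M : Matroid α} [M.Finite] {G : Finset α}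

/-- A subset `X` of `V` splits into its spine, `A` and `M` parts. -/
theorem card_filter_cells_eq {V : Finset α} {R₁ : Finset α} (hR₁g : R₁ ⊆ gr M) {c₂ c₃ : α}
    (hc₂g : c₂ ∈ gr M) (hc₃g : c₃ ∈ gr M) (hc₂ : c₂ ∉ clF M R₁) (hc₃ : c₃ ∉ clF M (insert c₂ R₁))
    (hcover : ∀ e ∈ V, e ∈ clF M (insert c₂ R₁) ∨ e ∈ clF M (insert c₃ R₁)) {X : Finset α} (hX : X ⊆ V) :
    (X.filter (fun e => e ∈ clF M R₁)).card +
      (X.filter (fun e => e ∈ V.filter (fun e => e ∈ clF M (insert c₂ R₁) ∧ e ∉ clF M R₁))).card +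
      (X.filter (fun e => e ∈ V.filter (fun e => e ∈ clF M (insert c₃ R₁) ∧ e ∉ clF M R₁))).card = X.card := by
  have h1 := Finset.card_filter_add_card_filter_not (s := X) (fun e => e ∈ clF M R₁)
  have h2 := Finset.card_filter_add_card_filter_not (s := X.filter (fun e => ¬ e ∈ clF M R₁))
    (fun e => e ∈ clF M (insert c₂ R₁))
  have hA : (X.filter (fun e => ¬ e ∈ clF M R₁)).filter (fun e => e ∈ clF M (insert c₂ R₁)) =
      X.filter (fun e => e ∈ V.filter (fun e => e ∈ clF M (insert c₂ R₁) ∧ e ∉ clF M R₁)) := by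
    ext e
    simp only [Finset.mem_filter]
    constructor
    · rintro ⟨⟨he, heL⟩, he2⟩; exact ⟨he, hX he, he2, heL⟩
    · rintro ⟨he, -, he2, heL⟩; exact ⟨⟨he, heL⟩, he2⟩
  have hM : (X.filter (fun e => ¬ e ∈ clF M R₁)).filter (fun e => ¬ e ∈ clF M (insert c₂ R₁)) =
      X.filter (fun e => e ∈ V.filter (fun e => e ∈ clF M (insert c₃ R₁) ∧ e ∉ clF M R₁)) := by
    ext e
    simp only [Finset.mem_filter]
    constructor
    · rintro ⟨⟨he, heL⟩, he2⟩
      refine ⟨he, hX he, ?_, heL⟩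
      rcases hcover e (hX he) with h | h
      · exact absurd h he2
      · exact h
    · rintro ⟨he, -, he3, heL⟩
      refine ⟨⟨he, heL⟩, fun he2 => heL ?_⟩
      exact mem_clF_of_mem_two_planes hR₁g hc₂g hc₃g hc₂ hc₃ he2 he3
  rw [hA, hM] at h2
  omega

/-- **The cell quantities of a lossy basis pair in the doubly degenerate regime** (see the module docstring). -/
theorem dd_cell_facts (hG : G ∈ flatsQ M (5 + 1)) (hd : (gr M \ G).card = 2)
    (hk : kColoops M G = 1) (hs : ∀ e ∈ gr M, ∀ f ∈ gr M, e ≠ f → rkN M {e, f} = 2)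
    (hfat : (fatClosures M 5 G 2).card ≤ 1) {B₀ : Finset α}
    (hB₀ : B₀ ∈ thinMembers M 5 G) {w₀ x : α} (hD : G \ clF M B₀ = {w₀, x}) (hne : w₀ ≠ x) {R₁ : Finset α}
    (hR₁V : R₁ ⊆ (G \ coloops M G) \ {w₀, x}) (hR₁2 : rkN M R₁ = 2) (hR₁3 : 3 ≤ R₁.card)
    (hcop : rkN M (insert w₀ (insert x R₁)) ≤ 3) {c₂ c₃ : α}
    (hc₂V : c₂ ∈ (G \ coloops M G) \ {w₀, x}) (hc₃V : c₃ ∈ (G \ coloops M G) \ {w₀, x})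
    (hc₂ : c₂ ∉ clF M R₁) (hc₃ : c₃ ∉ clF M (insert c₂ R₁))
    (hcover : ∀ e ∈ (G \ coloops M G) \ {w₀, x}, e ∈ clF M (insert c₂ R₁) ∨ e ∈ clF M (insert c₃ R₁))
    (hdeg₂ : rkN M (((G \ coloops M G) \ {w₀, x}).filter
      (fun e => e ∈ clF M (insert c₂ R₁) ∧ e ∉ clF M R₁)) ≤ 2)
    (hdeg₃ : rkN M (((G \ coloops M G) \ {w₀, x}).filter
      (fun e => e ∈ clF M (insert c₃ R₁) ∧ e ∉ clF M R₁)) ≤ 2)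
    {B : Finset α} (hB : B ∈ thinMembers M 5 G) (hnP : ¬ bigP M G B) {z : α} (hz : z ∈ G \ clF M B)
    (hw₀ : w₀ ∈ insert z B) (hx : x ∉ insert z B) :
    let V := (G \ coloops M G) \ {w₀, x}
    let P₀ := (insert z B \ coloops M G).erase w₀
    let W := (G \ insert z B).erase x
    let Aset := V.filter (fun e => e ∈ clF M (insert c₂ R₁) ∧ e ∉ clF M R₁)
    let Mset := V.filter (fun e => e ∈ clF M (insert c₃ R₁) ∧ e ∉ clF M R₁)
    (P₀.filter (fun e => e ∈ clF M R₁)).card + (P₀.filter (fun e => e ∈ Aset)).card +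
        (P₀.filter (fun e => e ∈ Mset)).card = 4 ∧
      (W.filter (fun e => e ∈ clF M R₁)).card + (W.filter (fun e => e ∈ Aset)).card +
        (W.filter (fun e => e ∈ Mset)).card = W.card ∧
      (P₀.filter (fun e => e ∈ clF M R₁)).card + (P₀.filter (fun e => e ∈ Aset)).card ≤ 3 ∧
      (P₀.filter (fun e => e ∈ clF M R₁)).card + (P₀.filter (fun e => e ∈ Mset)).card ≤ 3 ∧
      3 ≤ (W.filter (fun e => e ∈ clF M R₁)).card + (P₀.filter (fun e => e ∈ clF M R₁)).card ∧
      3 ≤ (P₀.filter (fun e => e ∈ Aset)).card + (W.filter (fun e => e ∈ Aset)).card ∧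
      3 ≤ (P₀.filter (fun e => e ∈ Mset)).card + (W.filter (fun e => e ∈ Mset)).card ∧
      ((P₀.filter (fun e => e ∈ Aset)).card ≤ (P₀.filter (fun e => e ∈ clF M Aset)).card ∧
        (W.filter (fun e => e ∈ Aset)).card ≤ (W.filter (fun e => e ∈ clF M Aset)).card ∧
        ((P₀.filter (fun e => e ∈ clF M Aset)).card - (P₀.filter (fun e => e ∈ Aset)).card) +
          ((W.filter (fun e => e ∈ clF M Aset)).card - (W.filter (fun e => e ∈ Aset)).card) ≤ 1) ∧
      ((P₀.filter (fun e => e ∈ Mset)).card ≤ (P₀.filter (fun e => e ∈ clF M Mset)).card ∧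
        (W.filter (fun e => e ∈ Mset)).card ≤ (W.filter (fun e => e ∈ clF M Mset)).card ∧
        ((P₀.filter (fun e => e ∈ clF M Mset)).card - (P₀.filter (fun e => e ∈ Mset)).card) +
          ((W.filter (fun e => e ∈ clF M Mset)).card - (W.filter (fun e => e ∈ Mset)).card) ≤ 1) := by
  intro V P₀ W Aset Mset
  have hGg : G ⊆ gr M := (mem_flatsQ.1 hG).1
  have hVg : V ⊆ gr M := fun e he => hGg (Finset.mem_sdiff.1 (Finset.mem_sdiff.1 he).1).1
  have hR₁g : R₁ ⊆ gr M := hR₁V.trans hVg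
  have hc₂g : c₂ ∈ gr M := hVg hc₂V
  have hc₃g : c₃ ∈ gr M := hVg hc₃V
  have hc₃L : c₃ ∉ clF M R₁ := fun h => hc₃ (clF_mono (Finset.subset_insert _ _) h)
  have hc₂' : c₂ ∉ clF M (insert c₃ R₁) := fun h =>
    hc₂ (mem_clF_of_mem_two_planes hR₁g hc₂g hc₃g hc₂ hc₃
      (subset_clF_of_subset_gr (Finset.insert_subset hc₂g hR₁g) (Finset.mem_insert_self _ _)) h)
  have hcover' : ∀ e ∈ V, e ∈ clF M (insert c₃ R₁) ∨ e ∈ clF M (insert c₂ R₁) := fun e he => (hcover e he).symm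
  have hAg : Aset ⊆ gr M := (Finset.filter_subset _ _).trans hVg
  have hMg : Mset ⊆ gr M := (Finset.filter_subset _ _).trans hVg
  have hPV : P₀ ⊆ V := basis_points_subset_V hB hz hx
  have hWV : W ⊆ V := W_subset_V hG hd hB hw₀
  have hPW : ∀ e ∈ P₀, e ∉ W := fun e he => basis_point_notMem_W he
  have hPorW : ∀ e ∈ V, e ∈ P₀ ∨ e ∈ W := fun e he => mem_basis_or_W_of_mem_V he
  have hP4 : P₀.card = 4 := card_basis_points hG hd hk hB₀ hD hB hnP hz hw₀
  have hPind : M.Indep (P₀ : Set α) := basis_points_indep hG hd hk hB hnP hz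
  -- (1), (2): the cells partition `P₀` and `W`
  have h1 := card_filter_cells_eq hR₁g hc₂g hc₃g hc₂ hc₃ hcover hPV
  have h2 := card_filter_cells_eq hR₁g hc₂g hc₃g hc₂ hc₃ hcover hWV
  rw [hP4] at h1
  -- a subset `S ⊆ V` splits into its `P₀` and `W` parts
  have hsplit : ∀ S ⊆ V, (P₀.filter (fun e => e ∈ S)).card + (W.filter (fun e => e ∈ S)).card = S.card := by
    intro S hS
    have := Finset.card_filter_add_card_filter_not (s := S) (fun e => e ∈ P₀)
    have e1 : S.filter (fun e => e ∈ P₀) = P₀.filter (fun e => e ∈ S) := by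
      ext e; simp only [Finset.mem_filter]; exact ⟨fun h => ⟨h.2, h.1⟩, fun h => ⟨h.2, h.1⟩⟩
    have e2 : S.filter (fun e => ¬ e ∈ P₀) = W.filter (fun e => e ∈ S) := by
      ext e; simp only [Finset.mem_filter]
      constructor
      · rintro ⟨he, heP⟩
        rcases hPorW e (hS he) with h | h
        · exact absurd h heP
        · exact ⟨h, he⟩
      · rintro ⟨heW, he⟩; exact ⟨he, fun heP => hPW e heP heW⟩
    rw [e1, e2] at this
    omega
  -- (3), (4): independent points of a plane
  have hπ₂ : rkN M (insert c₂ R₁) = 3 := by rw [rkN_insert_of_notMem_clF hc₂g hc₂, hR₁2]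
  have hπ₃ : rkN M (insert c₃ R₁) = 3 := by rw [rkN_insert_of_notMem_clF hc₃g hc₃L, hR₁2]
  have hplane : ∀ (c : α), c ∈ gr M → c ∉ clF M R₁ →
      (P₀.filter (fun e => e ∈ clF M R₁)).card +
        (P₀.filter (fun e => e ∈ V.filter (fun e => e ∈ clF M (insert c R₁) ∧ e ∉ clF M R₁))).card ≤
        (P₀.filter (fun e => e ∈ clF M (insert c R₁))).card := by
    intro c hcg hcL
    rw [← Finset.card_union_of_disjoint]
    · apply Finset.card_le_card
      intro e he
      rw [Finset.mem_union, Finset.mem_filter, Finset.mem_filter, Finset.mem_filter] at he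
      rw [Finset.mem_filter]
      rcases he with ⟨he, heL⟩ | ⟨he, -, he2, -⟩
      · exact ⟨he, clF_mono (Finset.subset_insert _ _) heL⟩
      · exact ⟨he, he2⟩
    · rw [Finset.disjoint_left]
      intro e he he'
      rw [Finset.mem_filter] at he he'
      exact (Finset.mem_filter.1 he'.2).2.2 he.2
  have h3 : (P₀.filter (fun e => e ∈ clF M R₁)).card + (P₀.filter (fun e => e ∈ Aset)).card ≤ 3 :=
    (hplane c₂ hc₂g hc₂).trans (hπ₂ ▸ card_filter_clF_le_rkN_of_indep hPind)
  have h4 : (P₀.filter (fun e => e ∈ clF M R₁)).card + (P₀.filter (fun e => e ∈ Mset)).card ≤ 3 :=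
    (hplane c₃ hc₃g hc₃L).trans (hπ₃ ▸ card_filter_clF_le_rkN_of_indep hPind)
  -- (5): `R₁ ⊆ V ∩ clF R₁`
  have h5 : 3 ≤ (W.filter (fun e => e ∈ clF M R₁)).card + (P₀.filter (fun e => e ∈ clF M R₁)).card := by
    have hsub : R₁ ⊆ V.filter (fun e => e ∈ clF M R₁) := fun e he =>
      Finset.mem_filter.2 ⟨hR₁V he, subset_clF_of_subset_gr hR₁g he⟩
    have := Finset.card_le_card hsub
    have hs' := hsplit (V.filter (fun e => e ∈ clF M R₁)) (Finset.filter_subset _ _)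
    have e1 : P₀.filter (fun e => e ∈ V.filter (fun e => e ∈ clF M R₁)) = P₀.filter (fun e => e ∈ clF M R₁) := by
      ext e; simp only [Finset.mem_filter]; exact ⟨fun h => ⟨h.1, h.2.2⟩, fun h => ⟨h.1, hPV h.1, h.2⟩⟩
    have e2 : W.filter (fun e => e ∈ V.filter (fun e => e ∈ clF M R₁)) = W.filter (fun e => e ∈ clF M R₁) := by
      ext e; simp only [Finset.mem_filter]; exact ⟨fun h => ⟨h.1, h.2.2⟩, fun h => ⟨h.1, hWV h.1, h.2⟩⟩
    rw [e1, e2] at hs'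
    omega
  -- (6), (7): three points in each side cell
  have hA3 : 3 ≤ Aset.card := three_le_card_side_of_fat hG hd hk hs hfat hB₀ hD hne hR₁V hR₁2 hR₁3 hcop hc₃V hc₂V
    hc₃L hc₂' hcover'
  have hM3 : 3 ≤ Mset.card := three_le_card_side_of_fat hG hd hk hs hfat hB₀ hD hne hR₁V hR₁2 hR₁3 hcop hc₂V hc₃V
    hc₂ hc₃ hcover
  have h6 : 3 ≤ (P₀.filter (fun e => e ∈ Aset)).card + (W.filter (fun e => e ∈ Aset)).card := by
    have := hsplit Aset (Finset.filter_subset _ _); omega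
  have h7 : 3 ≤ (P₀.filter (fun e => e ∈ Mset)).card + (W.filter (fun e => e ∈ Mset)).card := by
    have := hsplit Mset (Finset.filter_subset _ _); omega
  -- (8), (9): the line of a side cell has at most one extra point, on the spine
  have hline : ∀ (c : α), c ∈ gr M → c ∉ clF M R₁ →
      rkN M (V.filter (fun e => e ∈ clF M (insert c R₁) ∧ e ∉ clF M R₁)) ≤ 2 →
      c ∈ V →
      (P₀.filter (fun e => e ∈ V.filter (fun e => e ∈ clF M (insert c R₁) ∧ e ∉ clF M R₁))).card ≤
        (P₀.filter (fun e => e ∈ clF M (V.filter (fun e => e ∈ clF M (insert c R₁) ∧ e ∉ clF M R₁)))).card ∧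
      (W.filter (fun e => e ∈ V.filter (fun e => e ∈ clF M (insert c R₁) ∧ e ∉ clF M R₁))).card ≤
        (W.filter (fun e => e ∈ clF M (V.filter (fun e => e ∈ clF M (insert c R₁) ∧ e ∉ clF M R₁)))).card ∧
      ((P₀.filter (fun e => e ∈ clF M (V.filter (fun e => e ∈ clF M (insert c R₁) ∧ e ∉ clF M R₁)))).card -
          (P₀.filter (fun e => e ∈ V.filter (fun e => e ∈ clF M (insert c R₁) ∧ e ∉ clF M R₁))).card) +
        ((W.filter (fun e => e ∈ clF M (V.filter (fun e => e ∈ clF M (insert c R₁) ∧ e ∉ clF M R₁)))).card -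
          (W.filter (fun e => e ∈ V.filter (fun e => e ∈ clF M (insert c R₁) ∧ e ∉ clF M R₁))).card) ≤ 1 := by
    intro c hcg hcL hdeg hcV
    set S := V.filter (fun e => e ∈ clF M (insert c R₁) ∧ e ∉ clF M R₁) with hSdef
    have hSg : S ⊆ gr M := (Finset.filter_subset _ _).trans hVg
    have hSne : S.Nonempty := ⟨c, Finset.mem_filter.2 ⟨hcV,
      subset_clF_of_subset_gr (Finset.insert_subset hcg hR₁g) (Finset.mem_insert_self _ _), hcL⟩⟩
    have hScl : S ⊆ clF M S := subset_clF_of_subset_gr hSg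
    -- the excess points lie on the spine
    have hexc : ∀ e ∈ V, e ∈ clF M S → e ∉ S → e ∈ clF M R₁ := by
      intro e heV heS heS'
      by_contra heL
      apply heS'
      refine Finset.mem_filter.2 ⟨heV, ?_, heL⟩
      have : S ⊆ clF M (insert c R₁) := fun e' he' => (Finset.mem_filter.1 he').2.1
      exact clF_subset_clF_of_subset_clF this heS
    -- at most one point of `V` on the spine and on `clF S`
    have hone : (V.filter (fun e => e ∈ clF M R₁ ∧ e ∈ clF M S)).card ≤ 1 := by
      rw [Finset.card_le_one]
      intro a ha b hb
      rw [Finset.mem_filter] at ha hb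
      exact eq_of_mem_spine_of_mem_clF_side hs hVg hR₁g hR₁2 hdeg hSne (hVg ha.1) (hVg hb.1) ha.2.1 hb.2.1 ha.2.2 hb.2.2
    -- the `P₀` part
    have hP := Finset.card_filter_add_card_filter_not (s := P₀.filter (fun e => e ∈ clF M S)) (fun e => e ∈ S)
    have eP : (P₀.filter (fun e => e ∈ clF M S)).filter (fun e => e ∈ S) = P₀.filter (fun e => e ∈ S) := by
      ext e; simp only [Finset.mem_filter]; exact ⟨fun h => ⟨h.1.1, h.2⟩, fun h => ⟨⟨h.1, hScl h.2⟩, h.2⟩⟩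
    have hW := Finset.card_filter_add_card_filter_not (s := W.filter (fun e => e ∈ clF M S)) (fun e => e ∈ S)
    have eW : (W.filter (fun e => e ∈ clF M S)).filter (fun e => e ∈ S) = W.filter (fun e => e ∈ S) := by
      ext e; simp only [Finset.mem_filter]; exact ⟨fun h => ⟨h.1.1, h.2⟩, fun h => ⟨⟨h.1, hScl h.2⟩, h.2⟩⟩
    rw [eP] at hP
    rw [eW] at hW
    -- the two excess sets are disjoint subsets of the one-point set
    have hsub : (P₀.filter (fun e => e ∈ clF M S)).filter (fun e => ¬ e ∈ S) ∪
        (W.filter (fun e => e ∈ clF M S)).filter (fun e => ¬ e ∈ S) ⊆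
        V.filter (fun e => e ∈ clF M R₁ ∧ e ∈ clF M S) := by
      intro e he
      rw [Finset.mem_filter]
      rcases Finset.mem_union.1 he with h | h
      · obtain ⟨h', heS'⟩ := Finset.mem_filter.1 h
        obtain ⟨heP, heS⟩ := Finset.mem_filter.1 h'
        exact ⟨hPV heP, hexc e (hPV heP) heS heS', heS⟩
      · obtain ⟨h', heS'⟩ := Finset.mem_filter.1 h
        obtain ⟨heW, heS⟩ := Finset.mem_filter.1 h'
        exact ⟨hWV heW, hexc e (hWV heW) heS heS', heS⟩
    have hdisj : Disjoint ((P₀.filter (fun e => e ∈ clF M S)).filter (fun e => ¬ e ∈ S))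
        ((W.filter (fun e => e ∈ clF M S)).filter (fun e => ¬ e ∈ S)) := by
      rw [Finset.disjoint_left]
      intro e he he'
      rw [Finset.mem_filter, Finset.mem_filter] at he he'
      exact hPW e he.1.1 he'.1.1
    have := Finset.card_le_card hsub
    rw [Finset.card_union_of_disjoint hdisj] at this
    omega
  have hc₂V' : c₂ ∈ V := hc₂V
  have hc₃V' : c₃ ∈ V := hc₃V
  have h8 := hline c₂ hc₂g hc₂ hdeg₂ hc₂V'
  have h9 := hline c₃ hc₃g hc₃L hdeg₃ hc₃V'
  exact ⟨h1, h2, h3, h4, h5, h6, h7, h8, h9⟩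

end PercRepro.Shadow
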